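import Literature.MathematicalPhysics.QuantumFieldTheory.Balaban1983to89.B11Ineq73HasMajConcrete

/-!
# `Balaban1983to89.B11HKernelHasMajConcrete` — T. Bałaban, *The variational problem and background fields in renormalization group method for lattice gauge theories*, Commun. Math. Phys. **102** (1985) 277–309 [Balaban1985Variational], (45)–(46) p. 285 and (86), (190): THE H-KERNEL LETTER ([5] Theorem 3.12 in kernel form, the hypothesis `hHker` of the concrete (73)∕(190) files) IS THE (190) CHAIN'S BLOCK-MAJORANT LETTER `hH` ON THE CUBE SIZES — a kernel ↔ block-size dictionary entry; the end-to-end (190) chain at the concrete `C_j` with one letter fewer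

statement-level skeleton of published theorems with citation tags; proofs where landed; nothing here is a claim about the Yang–Mills mass gap

PDF held: `paper:balaban1985-cmp102-variational-background` (journal page = PDF page + 276); (45)–(46) p. 285 [PDF 9], (86) p. 291 [PDF 15],
(190) p. 308 [PDF 32] read by this seat; displays in the render-verified transcriptions of `B11Eq45HOperator` ((45)–(46)),
`B11Eq85FirstDerivative` ((86)), `B11SectG`∕`B11Ineq190Actual` ((190)).

CITATION HEADER (lean-in-tree rule 2026-08-18).  WHAT IS REPRODUCED: no new printed statement.  The (190) chain at the concrete `C_j`
(`B11Ineq73HasMajConcrete.ineq190_and_hmv_supSize_concreteC_kernel`, r08∕p06 lineage) carries the operator `H` of (45)–(46) TWICE: as the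
KERNEL letter `hHker` (*«H(b′, c₁)»* with the decay used in (86), p. 291: *«the first two lines of (86): |J| < C₁B₃ε₁(L^{j′}η)^{−3}, H-kernel
B₀(L^{j₁}η)^{−1−d}e^{−δ₀d}»* as read by the cell census; [5] Theorem 3.12), consumed by the concrete (73), AND as the BLOCK-MAJORANT letter
`hH : HasMaj (coarse sup size) (fine sup size) H (A_H·e^{−½δ₀d})` consumed by the abstract chain `B11Ineq190Actual` (the `U′ = I − H𝔇`
dressing).  THIS FILE derives the second from the first on the single-scale cube geometry (§2), so that the chain needs `hHker` only (§3).
(46) p. 285, verbatim: *«|HB| ≦ B₀|B|»* — the norm form; the kernel form is [5]'s Theorem 3.12 as quoted in `B11Eq73KernelConcrete`.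

THE MECHANISM ([3] (2.64)–(2.66) shape, `B11Ineq73HasMajConcrete.hasMaj_supSize_of_kernel`): kernel bounds `‖H(Y·e_{c″})(s)‖ ≦
κ(s, c″)‖Y‖` plus BLOCK ROW SUMS give a majorant between sup sizes.  Here the input is COARSE (bonds `c″ ∈ T`, block = base point, at
most `d` bonds per block: `card_filter_base_le`) and the output FINE (bonds `s ∈ S`, block = the `Lʲ`-cube of the base point); the row sum
over the `≦ d` coarse bonds at `y′` of `B₁e^{−δ₀|Lʲy′ − s|₁∕Lʲ}` is `≦ d·B₁·e^{dδ₀}·e^{−δ₀|y′ − ⌊s∕Lʲ⌋|₁}` by the OFFSET INEQUALITY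
`Lʲ|y′ − ⌊s∕Lʲ⌋|₁ ≦ |Lʲy′ − s|₁ + dLʲ` (§1, the same elementary fact as in the (73) file, where it is private; re-derived here at every rate).

WHAT IS CERTIFIED (kernel, sorry-free; axioms `propext` ∕ `Classical.choice` ∕ `Quot.sound`).
§1 `loK_cube_le_coord`, `lt_loK_cube_add_coord` (a fine site lies in its cube), **`l1_loK_cube_offset`** (the offset inequality),
   **`exp_offset_le_rate`** (`e^{−ρ|Lʲy − b|₁∕Lʲ} ≦ e^{ρd}·e^{−ρ|y − ⌊b∕Lʲ⌋|₁}` for every rate `ρ ≧ 0`), `card_filter_base_le` (at most `d` coarse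
   bonds of `T` share a base point) — adapted from the private §2 lemmas of `B11Ineq73HasMajConcrete`.
§2 **`hasMaj_H_of_kernel`** — for ANY continuous linear `H : (T → 𝔸) → (S → 𝔸)` with the kernel decay `hHker` (constant `B₁`, rate `δ₀ ≧ 0`):
   `HasMaj (supSize coarse) (supSize fine) H (d·B₁·e^{dδ₀} · e^{−δ₀|y − y′|₁})` on `cubeGeometry L j S T`; **`hasMaj_H_of_kernel_half`** — the
   same at the chain's rate `½δ₀` (monotonicity), i.e. EXACTLY the letter `hH` of `ineq190_and_hmv_supSize_concreteC_kernel` with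
   `A_H = d·B₁·e^{dδ₀}`.
§3 **`ineq190_and_hmv_supSize_concreteC_hker`** — `B11Ineq73HasMajConcrete.ineq190_and_hmv_supSize_concreteC_kernel` with the letter `hH`
   (and its constant `A_H`) DISCHARGED from `hHker`; hypotheses left: the located leaf (189) `h189`, the kernel letters of the ABSTRACT
   Sect. G data `G̃`, `Δ⁽²⁾H₀`, `H₀` on the cube sizes, `hHker` itself with its smallness `hq`, the Sect. G `Regime`, `W`-analyticity, (46),
   the Prop. 3 smallness — one letter fewer than before; **`ineq190_and_hmv_supSize_concreteC_kernels`** — the same with the block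
   letter `hH0` of the operator `H₀` of (129) ALSO discharged from a kernel letter `hH0ker` ((130): *«we use the bound (3.133) [5]»*;
   `A₀ := d·B₁′·e^{dδ₀}`), leaving (189), the abstract `G̃`∕`Δ⁽²⁾H₀` letters into the abstract size `b3`, and the two kernel letters.

HONEST SCOPE.  (i) Nothing of [5] Theorem 3.12 is proved: `hHker` stays a hypothesis (a cited external input, as in the (73) file); this
file only removes the REDUNDANT block form of the same input.  (ii) Single scale `Λ_j`, [5]'s abstract carrier (DIVERGENCE D-pv27.4
inherited); the constant `d·e^{dδ₀}` is this file's explicit witness of the «O(1)» of the block row sum.  (iii) Nothing of Propositions 3–9,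
Theorem 1, (B) UV stability or any summit statement is asserted; NOT summit progress.  No `def`, no new named fact; theorem-only module.
Unit `pub-ymgap-dag-n07-b-g0` (cell `pub-ymgap`, YM-DAG node N07 = [B11], -b₁ FIRST-MISSING-ESTIMATE seat).  Imports
`B11Ineq73HasMajConcrete` ONLY; modifies nothing there.
-/

noncomputable section

open scoped BigOperators
open Finset

namespace Literature.MathematicalPhysics.QuantumFieldTheory.Balaban1983to89.B11HKernelHasMajConcrete

open Literature.MathematicalPhysics.QuantumFieldTheory.Balaban1983to89
open B11SectG B11SupSize190 B11Ineq73HasMajConcrete B7Prop1Explicit B7Prop1Local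

/-! ## §1 The offset inequality between the fine `ℓ¹` distance and the block distance (every rate) -/

section Offset

variable {d : ℕ}

-- adapted from the private lemmas `loK_cube_le` / `lt_loK_cube_add` / `l1_loK_sub_ge` / `exp_offset_le` of `B11Ineq73HasMajConcrete`
/-- A fine site lies in its cube: `Lʲ·⌊x∕Lʲ⌋ ≦ x` coordinatewise (`L ≧ 1`). [folklore] [cite: Balaban1985Variational, (73) p.289] -/
theorem loK_cube_le_coord {L : ℕ} (hL : 1 ≤ L) (j : ℕ) (x : B7Prop1Explicit.Site d) (i : Fin d) : loK L j (cube L j x) i ≤ x i := by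
  have hpos : (0 : ℤ) < (L : ℤ) ^ j := by positivity
  have h : ((L : ℤ) ^ j) * (x i / (L : ℤ) ^ j) + x i % (L : ℤ) ^ j = x i := Int.mul_ediv_add_emod (x i) ((L : ℤ) ^ j)
  have hr := Int.emod_nonneg (x i) hpos.ne'
  simp only [loK, cube]
  linarith

/-- … and `x < Lʲ·(⌊x∕Lʲ⌋ + 1)` coordinatewise. [folklore] [cite: Balaban1985Variational, (73) p.289] -/
theorem lt_loK_cube_add_coord {L : ℕ} (hL : 1 ≤ L) (j : ℕ) (x : B7Prop1Explicit.Site d) (i : Fin d) :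
    x i < loK L j (cube L j x) i + (L : ℤ) ^ j := by
  have hpos : (0 : ℤ) < (L : ℤ) ^ j := by positivity
  have h : ((L : ℤ) ^ j) * (x i / (L : ℤ) ^ j) + x i % (L : ℤ) ^ j = x i := Int.mul_ediv_add_emod (x i) ((L : ℤ) ^ j)
  have hr := Int.emod_lt_of_pos (x i) hpos
  simp only [loK, cube]
  linarith

/-- **THE OFFSET INEQUALITY**: for a fine site `b` (cube `⌊b∕Lʲ⌋`) and a coarse site `y`, `Lʲ·|y − ⌊b∕Lʲ⌋|₁ ≦ |Lʲy − b|₁ + d·Lʲ`.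
[folklore] [cite: Balaban1985Variational, (73) p.289] -/
theorem l1_loK_cube_offset {L : ℕ} (hL : 1 ≤ L) (j : ℕ) (y b : B7Prop1Explicit.Site d) :
    (L : ℝ) ^ j * (l1 (y - cube L j b) : ℝ) ≤ (l1 (loK L j y - b) : ℝ) + d * (L : ℝ) ^ j := by
  have hcoord : ∀ i : Fin d, ((L : ℤ) ^ j) * |y i - cube L j b i| ≤ |loK L j y i - b i| + (L : ℤ) ^ j := by
    intro i
    have h1 := loK_cube_le_coord hL j b i
    have h2 := lt_loK_cube_add_coord hL j b i
    have hpos : (0 : ℤ) < (L : ℤ) ^ j := by positivity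
    have hloK : loK L j y i = (L : ℤ) ^ j * y i := rfl
    have hloKq : loK L j (cube L j b) i = (L : ℤ) ^ j * cube L j b i := rfl
    rw [hloK]
    rw [hloKq] at h1 h2
    have key : ((L : ℤ) ^ j) * |y i - cube L j b i| = |(L : ℤ) ^ j * y i - (L : ℤ) ^ j * cube L j b i| := by
      rw [← mul_sub, abs_mul, abs_of_pos hpos]
    rw [key]
    have htri : |(L : ℤ) ^ j * y i - (L : ℤ) ^ j * cube L j b i|
        ≤ |(L : ℤ) ^ j * y i - b i| + |b i - (L : ℤ) ^ j * cube L j b i| :=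
      abs_sub_le ((L : ℤ) ^ j * y i) (b i) ((L : ℤ) ^ j * cube L j b i)
    have hsmall : |b i - (L : ℤ) ^ j * cube L j b i| ≤ (L : ℤ) ^ j := by
      rw [abs_of_nonneg (by linarith)]
      linarith
    linarith
  have hsum : ((L : ℤ) ^ j) * (l1 (y - cube L j b) : ℤ) ≤ (l1 (loK L j y - b) : ℤ) + d * (L : ℤ) ^ j := by
    simp only [l1, Nat.cast_sum, Int.natCast_natAbs, Pi.sub_apply, Finset.mul_sum]
    calc ∑ i, (L : ℤ) ^ j * |y i - cube L j b i| ≤ ∑ i : Fin d, (|loK L j y i - b i| + (L : ℤ) ^ j) :=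
          Finset.sum_le_sum fun i _ => hcoord i
      _ = ∑ i, |loK L j y i - b i| + d * (L : ℤ) ^ j := by
          rw [Finset.sum_add_distrib, Finset.sum_const, Finset.card_univ, Fintype.card_fin]; simp
  have hcast : ((L : ℝ) ^ j) * (l1 (y - cube L j b) : ℝ) = (((((L : ℤ) ^ j) * (l1 (y - cube L j b) : ℤ)) : ℤ) : ℝ) := by
    push_cast; ring
  rw [hcast]
  have h2 : ((l1 (loK L j y - b) : ℝ) + d * (L : ℝ) ^ j) = ((((l1 (loK L j y - b) : ℤ) + d * (L : ℤ) ^ j : ℤ)) : ℝ) := by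
    push_cast; ring
  rw [h2]
  exact_mod_cast hsum

/-- **THE DECAY OFFSET AT EVERY RATE**: `e^{−ρ·|Lʲy − b|₁∕Lʲ} ≦ e^{ρd}·e^{−ρ|y − ⌊b∕Lʲ⌋|₁}` (`ρ ≧ 0`, `L ≧ 1`). [folklore]
[cite: Balaban1985Variational, (73) p.289, (86) p.291] -/
theorem exp_offset_le_rate {L : ℕ} (hL : 1 ≤ L) (j : ℕ) {ρ : ℝ} (hρ : 0 ≤ ρ) (y b : B7Prop1Explicit.Site d) :
    Real.exp (-(ρ * ((l1 (loK L j y - b) : ℝ) / (L : ℝ) ^ j)))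
      ≤ Real.exp (ρ * d) * Real.exp (-(ρ * (l1 (y - cube L j b) : ℝ))) := by
  rw [← Real.exp_add]
  apply Real.exp_le_exp.2
  have hLj : (0 : ℝ) < (L : ℝ) ^ j := by positivity
  have h := l1_loK_cube_offset hL j y b
  have h' : (l1 (y - cube L j b) : ℝ) - d ≤ (l1 (loK L j y - b) : ℝ) / (L : ℝ) ^ j := by
    rw [le_div_iff₀ hLj]
    nlinarith
  nlinarith

/-- **AT MOST `d` COARSE BONDS PER BASE POINT**: the bonds of `T` with base point `y` inject into the `d` directions.
[cite: Balaban1985Variational, (45) p.285 («B : 𝔅_k → 𝔤»)] -/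
theorem card_filter_base_le (T : Finset (B7Prop1Explicit.Site d × Fin d)) (y : B7Prop1Explicit.Site d) :
    ((Finset.univ : Finset T).filter (fun c : T => c.1.1 = y)).card ≤ d := by
  classical
  have hinj : Set.InjOn (fun c : T => c.1.2) ↑((Finset.univ : Finset T).filter (fun c : T => c.1.1 = y)) := by
    intro a ha b hb h
    rw [Finset.coe_filter] at ha hb
    apply Subtype.ext
    exact Prod.ext (ha.2.trans hb.2.symm) h
  calc ((Finset.univ : Finset T).filter (fun c : T => c.1.1 = y)).card
      ≤ (Finset.univ : Finset (Fin d)).card :=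
        Finset.card_le_card_of_injOn (fun c : T => c.1.2) (fun _ _ => Finset.mem_univ _) hinj
    _ = d := by rw [Finset.card_univ, Fintype.card_fin]

end Offset

/-! ## §2 The H-kernel letter IS the block-majorant letter on the cube sizes -/

section Dictionary

variable {d : ℕ} {𝔸 : Type} [NormedRing 𝔸] [NormedAlgebra ℂ 𝔸]

/-- **[5] THEOREM 3.12 IN KERNEL FORM ⇒ THE (190) CHAIN'S LETTER `hH` AT RATE `δ₀`**: for ANY continuous linear `H : (T → 𝔸) → (S → 𝔸)`
with `‖H(Y·e_{c″})(s)‖ ≦ B₁·e^{−δ₀|Lʲc″ − s|₁∕Lʲ}·‖Y‖` (`hHker`, `B₁, δ₀ ≧ 0`), the block majorant between the coarse and the fine sup sizes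
of the single-scale cube geometry is `d·B₁·e^{dδ₀}·e^{−δ₀|y − y′|₁}` (`≦ d` coarse bonds per block, offset inequality of §1).
[cite: Balaban1985Variational, (45)–(46) p.285, (86) p.291, (190) p.308] [cite: Balaban1984PropagatorsII, (2.64)–(2.66) p.235] -/
theorem hasMaj_H_of_kernel {L : ℕ} (hL : 1 ≤ L) (j : ℕ) (S T : Finset (B7Prop1Explicit.Site d × Fin d)) (H : (T → 𝔸) →L[ℂ] (S → 𝔸))
    {B₁ δ₀ : ℝ} (hB₁ : 0 ≤ B₁) (hδ₀ : 0 ≤ δ₀)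
    (hHker : ∀ (c'' : T) (Y : 𝔸) (s : S),
      ‖H (Pi.single c'' Y) s‖ ≤ B₁ * Real.exp (-(δ₀ * ((l1 (loK L j c''.1.1 - s.1.1) : ℝ) / (L : ℝ) ^ j))) * ‖Y‖) :
    HasMaj (supSize (cubeGeometry L j S T) (boxT L j S T) (blkT L j S T) : BlockNorm (cubeGeometry L j S T) (T → 𝔸))
      (supSize (cubeGeometry L j S T) (boxS L j S T) (blkS L j S T) : BlockNorm (cubeGeometry L j S T) (S → 𝔸))
      (H.restrictScalars ℝ : (T → 𝔸) →ₗ[ℝ] (S → 𝔸))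
      (fun y y' => d * B₁ * Real.exp (d * δ₀) * Real.exp (-(δ₀ * (cubeGeometry L j S T).dist y y'))) := by
  classical
  refine hasMaj_supSize_of_kernel (boxT L j S T) (blkT L j S T) (boxS L j S T) (blkS L j S T)
    (fun c => Finset.mem_filter.2 ⟨Finset.mem_univ _, rfl⟩) _
    (fun s c'' => B₁ * Real.exp (-(δ₀ * ((l1 (loK L j c''.1.1 - s.1.1) : ℝ) / (L : ℝ) ^ j))))
    (fun s c'' => by positivity) (fun c'' Y s => ?_) _ (fun y y' => by positivity) (fun y y' s hs => ?_)
  · -- the kernel bound is `hHker`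
    exact hHker c'' Y s
  · -- the block row sum over the ≤ d coarse bonds based at y′
    have hs' : cube L j s.1.1 = Subtype.val y := by
      have := (Finset.mem_filter.1 hs).2
      exact congrArg Subtype.val this
    set F := (Finset.univ : Finset T).filter (fun c : T => blkT L j S T c = y') with hF_def
    have hFsub : F ⊆ (Finset.univ : Finset T).filter (fun c : T => c.1.1 = Subtype.val y') := by
      intro c hc
      rw [hF_def, Finset.mem_filter] at hc
      exact Finset.mem_filter.2 ⟨Finset.mem_univ _, congrArg Subtype.val hc.2⟩
    have hFcard : (F.card : ℝ) ≤ d := by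
      have h1 := (Finset.card_le_card hFsub).trans (card_filter_base_le T (Subtype.val y'))
      exact_mod_cast h1
    have hterm : ∀ c ∈ F, B₁ * Real.exp (-(δ₀ * ((l1 (loK L j c.1.1 - s.1.1) : ℝ) / (L : ℝ) ^ j)))
        ≤ B₁ * (Real.exp (δ₀ * d) * Real.exp (-(δ₀ * (l1 (Subtype.val y - Subtype.val y') : ℝ)))) := by
      intro c hc
      rw [hF_def, Finset.mem_filter] at hc
      have hcy : c.1.1 = Subtype.val y' := congrArg Subtype.val hc.2
      have h := exp_offset_le_rate hL j hδ₀ c.1.1 s.1.1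
      rw [hcy, hs'] at h
      have hsym : (l1 (Subtype.val y' - Subtype.val y) : ℝ) = (l1 (Subtype.val y - Subtype.val y') : ℝ) := by
        rw [← l1_neg, neg_sub]
      rw [hsym] at h
      rw [hcy]
      exact mul_le_mul_of_nonneg_left h hB₁
    calc ∑ c ∈ F, B₁ * Real.exp (-(δ₀ * ((l1 (loK L j c.1.1 - s.1.1) : ℝ) / (L : ℝ) ^ j)))
        ≤ ∑ c ∈ F, B₁ * (Real.exp (δ₀ * d) * Real.exp (-(δ₀ * (l1 (Subtype.val y - Subtype.val y') : ℝ)))) :=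
          Finset.sum_le_sum hterm
      _ = F.card * (B₁ * (Real.exp (δ₀ * d) * Real.exp (-(δ₀ * (l1 (Subtype.val y - Subtype.val y') : ℝ))))) := by
          rw [Finset.sum_const, nsmul_eq_mul]
      _ ≤ d * (B₁ * (Real.exp (δ₀ * d) * Real.exp (-(δ₀ * (l1 (Subtype.val y - Subtype.val y') : ℝ))))) :=
          mul_le_mul_of_nonneg_right hFcard (by positivity)
      _ = d * B₁ * Real.exp (d * δ₀) * Real.exp (-(δ₀ * (cubeGeometry L j S T).dist y y')) := by
          rw [dist_cubeGeometry, mul_comm δ₀ (d : ℝ)]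
          ring

/-- **THE SAME AT THE CHAIN'S RATE `½δ₀`** — EXACTLY the letter `hH` of `B11Ineq73HasMajConcrete.ineq190_and_hmv_supSize_concreteC_kernel`
with `A_H = d·B₁·e^{dδ₀}` (`e^{−δ₀d} ≦ e^{−½δ₀d}`, distances `≧ 0`). [cite: Balaban1985Variational, (46) p.285, (190) p.308] -/
theorem hasMaj_H_of_kernel_half {L : ℕ} (hL : 1 ≤ L) (j : ℕ) (S T : Finset (B7Prop1Explicit.Site d × Fin d)) (H : (T → 𝔸) →L[ℂ] (S → 𝔸))
    {B₁ δ₀ : ℝ} (hB₁ : 0 ≤ B₁) (hδ₀ : 0 ≤ δ₀)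
    (hHker : ∀ (c'' : T) (Y : 𝔸) (s : S),
      ‖H (Pi.single c'' Y) s‖ ≤ B₁ * Real.exp (-(δ₀ * ((l1 (loK L j c''.1.1 - s.1.1) : ℝ) / (L : ℝ) ^ j))) * ‖Y‖) :
    HasMaj (supSize (cubeGeometry L j S T) (boxT L j S T) (blkT L j S T) : BlockNorm (cubeGeometry L j S T) (T → 𝔸))
      (supSize (cubeGeometry L j S T) (boxS L j S T) (blkS L j S T) : BlockNorm (cubeGeometry L j S T) (S → 𝔸))
      (H.restrictScalars ℝ : (T → 𝔸) →ₗ[ℝ] (S → 𝔸))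
      (fun y y' => d * B₁ * Real.exp (d * δ₀) * Real.exp (-(δ₀ / 2 * (cubeGeometry L j S T).dist y y'))) := by
  refine (hasMaj_H_of_kernel hL j S T H hB₁ hδ₀ hHker).mono fun y y' => ?_
  have hdist : 0 ≤ (cubeGeometry L j S T).dist y y' := dist_nonneg_cubeGeometry L j S T y y'
  have hexp : Real.exp (-(δ₀ * (cubeGeometry L j S T).dist y y')) ≤ Real.exp (-(δ₀ / 2 * (cubeGeometry L j S T).dist y y')) :=
    Real.exp_le_exp.2 (by nlinarith)
  exact mul_le_mul_of_nonneg_left hexp (by positivity)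

end Dictionary

/-! ## §3 The (190) chain at the concrete `C_j` with the letter `hH` discharged from `hHker` -/

section Chain

open B7Prop2Explicit B7Prop3Flat B7Prop4Flat B7Eq92Concrete B7Prop3GeneralLinear
  B7Prop4GeneralLevels B7Prop5GeneralOperators B7Prop5GeneralInduction B7Prop5GeneralLevels B7Prop5General B7Ineq149Pairing
  B13Contraction113 B11Eq44Concrete B11Prop3Model B11Eq174Chart B11Eq183Differentiation B11Presentation190 B11Ineq190Actual
  B11Ineq190FromProp3 B6RandomWalk Set Metric

variable {d : ℕ} {𝔸 : Type} [NormedRing 𝔸] [NormedAlgebra ℂ 𝔸] [CompleteSpace 𝔸] [NormOneClass 𝔸]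

variable (L : ℕ) (hL : 2 ≤ L) {G : Subgroup 𝔸ˣ} (hG : AvgClosed d L G) (k : ℕ)
  (U₀ : B7Prop1Explicit.Site d → Fin d → 𝔸ˣ) (hU₀ : ∀ x κ, U₀ x κ ∈ G) {α₀ : ℝ} (hα : 0 < α₀)
  (hα3 : C0 d * α₀ ≤ 1 / 3) (hα4 : 4 * α₀ ≤ c2' d L) (h52 : pdev U₀ < α₀ * (((L : ℝ) ^ k)⁻¹) ^ 2)
  {b : ℝ} (hb : 0 < b)
  (hsmall : Real.exp (4 * (800 * ((d : ℝ) + 1) ^ 2 * ((d : ℝ) + 4)) * α₀)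
    * (1 + 8 * (131072 * ((d : ℝ) + 1) ^ 2) * ((L : ℝ) ^ k * b)) ≤ 2)
  (hc₃ : 4 * ((L : ℝ) ^ k * b) < c3 d L)
  (h145 : 8 * d * thetaGen d L α₀ * (L : ℝ)⁻¹ ^ 4 ≤ 1)
  (h155 : (2 * (L : ℝ) - 1) * (L : ℝ)⁻¹ ^ 2 + 2 * d * thetaGen d L α₀ * (L : ℝ)⁻¹ ^ 3
    + 1 / 8 * (1 + 2 * d * thetaGen d L α₀ * (L : ℝ)⁻¹ ^ 2 + 2 * d * C3Gen d L * ((L : ℝ) ^ k * b)) * (L : ℝ)⁻¹ ^ 2 ≤ 1)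
  (S T : Finset (B7Prop1Explicit.Site d × Fin d))

variable {𝒵 : Type} [NormedAddCommGroup 𝒵] [NormedSpace ℂ 𝒵] [CompleteSpace 𝒵]
  {𝒢 : 𝒵 →L[ℂ] (S → 𝔸)} {W : (S → 𝔸) → 𝒵} {D2 : (S → 𝔸) →L[ℂ] 𝒵} {H₀ : (T → 𝔸) →L[ℂ] (S → 𝔸)} {B₀ θ C₄ a₃ jG a ε₄ : ℝ}
  {X : Type} {E : Type} [NormedAddCommGroup E] [NormedSpace ℝ E]

include hL hG hU₀ hα hα3 hα4 h52 hb hsmall hc₃ h145 h155 in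
/-- **THE END-TO-END (190) CHAIN AT THE CONCRETE `C_j`, LETTERS (73) AND `hH` DISCHARGED** —
`B11Ineq73HasMajConcrete.ineq190_and_hmv_supSize_concreteC_kernel` with its hypothesis `hH` (the block majorant of `H` between the cube sup
sizes, constant `A_H`, rate `½δ₀`) supplied by §2 from the kernel letter `hHker` that the statement already carries (`A_H := d·B₁·e^{dδ₀}`).
Hypotheses left: the located leaf (189) `h189`, the kernel letters of the ABSTRACT Sect. G data `G̃` (`hG190`), `Δ⁽²⁾H₀` (`hD2H0`), `H₀` (`hH0`)
on the cube sizes, the presentation letters `ev`∕`hev`∕`Hl`∕`dH`, `hHker` with its smallness `hq`, the Sect. G `Regime`, `W`-analyticity, (46)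
`hH46`, the Prop. 3 smallness `h18`∕`h2`, `hnest`, `q_G < 1`. [cite: Balaban1985Variational, Prop. 9 (190) pp.308–309, (73) p.289, (46) p.285]
[cite: Balaban1984PropagatorsII, Lemma 2.1 (2.61) p.234] -/
theorem ineq190_and_hmv_supSize_concreteC_hker {j : ℕ} (hj : j ≤ k) (hd1 : 1 ≤ d)
    (R : Regime 𝒢 0 W B₀ θ C₄ a₃ jG a ε₄) (hWa : AnalyticOnNhd ℂ W {Y : S → 𝔸 | ‖Y‖ < a₃})
    (H : (T → 𝔸) →L[ℂ] (S → 𝔸)) {B₀' : ℝ} (hB₀' : 0 ≤ B₀') (hH46 : ∀ X, ‖H X‖ ≤ B₀' * ‖X‖)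
    {c1h ε₃ : ℝ} (hc1h : 1 ≤ c1h) (hε₃ : 0 < ε₃)
    (h18 : 18 * ((8 * (131072 * ((d : ℝ) + 1) ^ 2) * Real.exp (4 * (800 * ((d : ℝ) + 1) ^ 2 * ((d : ℝ) + 4)) * α₀)) *
      ((L : ℝ) ^ j) ^ 2) * B₀' * d * c1h * ε₃ ≤ 1) (h2 : 2 * ε₃ ≤ b / 2) (hnest : ε₄ + a ≤ ε₃)
    {δ₀ B₁ : ℝ} (hδ₀ : 0 < δ₀) (hB₁ : 0 ≤ B₁)
    (hHker : ∀ (c'' : T) (Y : 𝔸) (s : S),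
      ‖H (Pi.single c'' Y) s‖ ≤ B₁ * Real.exp (-(δ₀ * ((l1 (loK L j c''.1.1 - s.1.1) : ℝ) / (L : ℝ) ^ j))) * ‖Y‖)
    (hq : (C3Gen d L * (((L : ℝ) ^ j) ^ 2 * (2 * ε₃)) * (2 * d) * B₁ * Real.exp (2 * d * δ₀)) * (d * B6.c0 δ₀ (1 / 2) ^ d) < 1)
    {B : T → 𝔸} (hB : ‖H₀ B‖ < a ∧ ‖D2 (H₀ B)‖ < jG)
    {box : (cubeGeometry L j S T).Site → Finset X} {blk : X → (cubeGeometry L j S T).Site} (ev : X → ((S → 𝔸) →L[ℝ] E))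
    {b3 : BlockNorm (cubeGeometry L j S T) 𝒵}
    (hev : ∀ (y : (cubeGeometry L j S T).Site) (v : S → 𝔸), ∀ x ∈ box y,
      ‖ev x v‖ ≤ (supSize (cubeGeometry L j S T) (boxS L j S T) (blkS L j S T) :
        BlockNorm (cubeGeometry L j S T) (S → 𝔸)).loc y v)
    {BG θW cΔ A₀ : ℝ} (hBG : 0 ≤ BG) (hθW : 0 ≤ θW) (hcΔ : 0 ≤ cΔ) (hA₀ : 0 ≤ A₀)
    (hG190 : HasMaj b3 (supSize (cubeGeometry L j S T) (boxS L j S T) (blkS L j S T) : BlockNorm (cubeGeometry L j S T) (S → 𝔸))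
      (𝒢.restrictScalars ℝ : 𝒵 →ₗ[ℝ] (S → 𝔸)) (fun y y' => BG * Real.exp (-(δ₀ * (cubeGeometry L j S T).dist y y'))))
    (hD2H0 : HasMaj (supSize (cubeGeometry L j S T) (boxT L j S T) (blkT L j S T) : BlockNorm (cubeGeometry L j S T) (T → 𝔸)) b3
      ((D2 ∘L H₀).restrictScalars ℝ : (T → 𝔸) →ₗ[ℝ] 𝒵) (fun y y' => cΔ * Real.exp (-(δ₀ * (cubeGeometry L j S T).dist y y'))))
    (hH0 : HasMaj (supSize (cubeGeometry L j S T) (boxT L j S T) (blkT L j S T) : BlockNorm (cubeGeometry L j S T) (T → 𝔸))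
      (supSize (cubeGeometry L j S T) (boxS L j S T) (blkS L j S T) : BlockNorm (cubeGeometry L j S T) (S → 𝔸))
      (H₀.restrictScalars ℝ : (T → 𝔸) →ₗ[ℝ] (S → 𝔸)) (fun y y' => A₀ * Real.exp (-(δ₀ * (cubeGeometry L j S T).dist y y'))))
    (h189 : ∀ B' : T → 𝔸, ‖H₀ B'‖ < a → ‖D2 (H₀ B')‖ < jG →
      Ineq189 (supSize (cubeGeometry L j S T) (boxS L j S T) (blkS L j S T) : BlockNorm (cubeGeometry L j S T) (S → 𝔸)) b3
        ((fderiv ℂ W (solA180 𝒢 W D2 H₀ ε₄ B' + H₀ B')).restrictScalars ℝ : (S → 𝔸) →ₗ[ℝ] 𝒵) θW δ₀)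
    (hqG : qG b3.κ 1 BG θW (B6.c0 δ₀ (1 / 8) ^ d) < 1)
    (Hl : (T → 𝔸) → X → E) (dH : Icc (0:ℝ) 1 → (T → 𝔸) →ₗ[ℝ] (X → E))
    (hHl : ∀ B' : T → 𝔸, Hl B' = fun x => ev x (chartH179 𝒢 W D2 H₀
      (fun Y : S → 𝔸 => Y - H (Dfix (B11Eq44Concrete.Cmap L U₀ S T j) (H : (T → 𝔸) →ₗ[ℂ] (S → 𝔸))
        ((8 * (131072 * ((d : ℝ) + 1) ^ 2) * Real.exp (4 * (800 * ((d : ℝ) + 1) ^ 2 * ((d : ℝ) + 4)) * α₀)) * ((L : ℝ) ^ j) ^ 2) Y))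
      ε₄ B'))
    (hdH : ∀ t : Icc (0:ℝ) 1, dH t = (LinearMap.pi fun x => ((ev x : (S → 𝔸) →L[ℝ] E) : (S → 𝔸) →ₗ[ℝ] E)) ∘ₗ
      ((fderiv ℂ (chartH179 𝒢 W D2 H₀
        (fun Y : S → 𝔸 => Y - H (Dfix (B11Eq44Concrete.Cmap L U₀ S T j) (H : (T → 𝔸) →ₗ[ℂ] (S → 𝔸))
          ((8 * (131072 * ((d : ℝ) + 1) ^ 2) * Real.exp (4 * (800 * ((d : ℝ) + 1) ^ 2 * ((d : ℝ) + 4)) * α₀)) * ((L : ℝ) ^ j) ^ 2) Y))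
        ε₄) ((t : ℝ) • B)).restrictScalars ℝ : (T → 𝔸) →ₗ[ℝ] (S → 𝔸)))
    (y : (cubeGeometry L j S T).Site) :
    (∀ t : Icc (0:ℝ) 1, Ineq190 (supSize (cubeGeometry L j S T) (boxT L j S T) (blkT L j S T) : BlockNorm (cubeGeometry L j S T) (T → 𝔸))
        (supSize (cubeGeometry L j S T) box blk : BlockNorm (cubeGeometry L j S T) (X → E)) (dH t)
        (const190 1 1 b3.κ BG θW cΔ A₀ (d * B₁ * Real.exp (d * δ₀))
          (d * Real.exp (1 / 2 * d * δ₀) *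
            ((1 - (C3Gen d L * (((L : ℝ) ^ j) ^ 2 * (2 * ε₃)) * (2 * d) * B₁ * Real.exp (2 * d * δ₀)) *
                (d * B6.c0 δ₀ (1 / 2) ^ d))⁻¹ * (Real.exp (d * δ₀) * (C3Gen d L * ((L : ℝ) ^ j) ^ 2 * (2 * ε₃)))))
          (B6.c0 δ₀ (1 / 8) ^ d)) δ₀) ∧
      ∀ s : ℝ, (∀ t, (supSize (cubeGeometry L j S T) box blk : BlockNorm (cubeGeometry L j S T) (X → E)).loc y (dH t B) ≤ s) →
        (supSize (cubeGeometry L j S T) box blk : BlockNorm (cubeGeometry L j S T) (X → E)).loc y (Hl B) ≤ s := by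
  have hL1 : 1 ≤ L := le_trans (by norm_num) hL
  have hAH : 0 ≤ (d : ℝ) * B₁ * Real.exp (d * δ₀) := by positivity
  have hH := hasMaj_H_of_kernel_half hL1 j S T H hB₁ hδ₀.le hHker
  exact ineq190_and_hmv_supSize_concreteC_kernel L hL hG k U₀ hU₀ hα hα3 hα4 h52 hb hsmall hc₃ h145 h155 S T hj hd1 R hWa H hB₀'
    hH46 hc1h hε₃ h18 h2 hnest hδ₀ hB₁ hHker hq hB ev hev hBG hθW hcΔ hA₀ hAH hG190 hD2H0 hH0 hH h189 hqG Hl dH hHl hdH y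

include hL hG hU₀ hα hα3 hα4 h52 hb hsmall hc₃ h145 h155 in
/-- **THE SAME WITH BOTH COARSE-TO-FINE LETTERS IN KERNEL FORM** — the chain's block letter `hH0` for the operator `H₀` of (129) ((130):
*«we use the bound (3.133) [5]»*; tree: `B11KernelDictionary.hH0Shape_of_B9_ineq3133` reads it as a kernel bound) is discharged by §2 exactly
like `hH`: from a kernel letter `hH0ker` with constant `B₁′` and rate `δ₀` one gets `hH0` with `A₀ := d·B₁′·e^{dδ₀}` at rate `δ₀`.  Hypotheses
left: (189) `h189`, the letters of the ABSTRACT `G̃` (`hG190`) and `Δ⁽²⁾H₀` (`hD2H0`) into the abstract size `b3`, the two KERNEL letters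
`hHker`∕`hH0ker`, presentation letters, regimes and smallness. [cite: Balaban1985Variational, Prop. 9 (190) pp.308–309, (129)–(130) p.297, (46) p.285] -/
theorem ineq190_and_hmv_supSize_concreteC_kernels {j : ℕ} (hj : j ≤ k) (hd1 : 1 ≤ d)
    (R : Regime 𝒢 0 W B₀ θ C₄ a₃ jG a ε₄) (hWa : AnalyticOnNhd ℂ W {Y : S → 𝔸 | ‖Y‖ < a₃})
    (H : (T → 𝔸) →L[ℂ] (S → 𝔸)) {B₀' : ℝ} (hB₀' : 0 ≤ B₀') (hH46 : ∀ X, ‖H X‖ ≤ B₀' * ‖X‖)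
    {c1h ε₃ : ℝ} (hc1h : 1 ≤ c1h) (hε₃ : 0 < ε₃)
    (h18 : 18 * ((8 * (131072 * ((d : ℝ) + 1) ^ 2) * Real.exp (4 * (800 * ((d : ℝ) + 1) ^ 2 * ((d : ℝ) + 4)) * α₀)) *
      ((L : ℝ) ^ j) ^ 2) * B₀' * d * c1h * ε₃ ≤ 1) (h2 : 2 * ε₃ ≤ b / 2) (hnest : ε₄ + a ≤ ε₃)
    {δ₀ B₁ B₁' : ℝ} (hδ₀ : 0 < δ₀) (hB₁ : 0 ≤ B₁) (hB₁' : 0 ≤ B₁')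
    (hHker : ∀ (c'' : T) (Y : 𝔸) (s : S),
      ‖H (Pi.single c'' Y) s‖ ≤ B₁ * Real.exp (-(δ₀ * ((l1 (loK L j c''.1.1 - s.1.1) : ℝ) / (L : ℝ) ^ j))) * ‖Y‖)
    (hH0ker : ∀ (c'' : T) (Y : 𝔸) (s : S),
      ‖H₀ (Pi.single c'' Y) s‖ ≤ B₁' * Real.exp (-(δ₀ * ((l1 (loK L j c''.1.1 - s.1.1) : ℝ) / (L : ℝ) ^ j))) * ‖Y‖)
    (hq : (C3Gen d L * (((L : ℝ) ^ j) ^ 2 * (2 * ε₃)) * (2 * d) * B₁ * Real.exp (2 * d * δ₀)) * (d * B6.c0 δ₀ (1 / 2) ^ d) < 1)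
    {B : T → 𝔸} (hB : ‖H₀ B‖ < a ∧ ‖D2 (H₀ B)‖ < jG)
    {box : (cubeGeometry L j S T).Site → Finset X} {blk : X → (cubeGeometry L j S T).Site} (ev : X → ((S → 𝔸) →L[ℝ] E))
    {b3 : BlockNorm (cubeGeometry L j S T) 𝒵}
    (hev : ∀ (y : (cubeGeometry L j S T).Site) (v : S → 𝔸), ∀ x ∈ box y,
      ‖ev x v‖ ≤ (supSize (cubeGeometry L j S T) (boxS L j S T) (blkS L j S T) :
        BlockNorm (cubeGeometry L j S T) (S → 𝔸)).loc y v)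
    {BG θW cΔ : ℝ} (hBG : 0 ≤ BG) (hθW : 0 ≤ θW) (hcΔ : 0 ≤ cΔ)
    (hG190 : HasMaj b3 (supSize (cubeGeometry L j S T) (boxS L j S T) (blkS L j S T) : BlockNorm (cubeGeometry L j S T) (S → 𝔸))
      (𝒢.restrictScalars ℝ : 𝒵 →ₗ[ℝ] (S → 𝔸)) (fun y y' => BG * Real.exp (-(δ₀ * (cubeGeometry L j S T).dist y y'))))
    (hD2H0 : HasMaj (supSize (cubeGeometry L j S T) (boxT L j S T) (blkT L j S T) : BlockNorm (cubeGeometry L j S T) (T → 𝔸)) b3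
      ((D2 ∘L H₀).restrictScalars ℝ : (T → 𝔸) →ₗ[ℝ] 𝒵) (fun y y' => cΔ * Real.exp (-(δ₀ * (cubeGeometry L j S T).dist y y'))))
    (h189 : ∀ B' : T → 𝔸, ‖H₀ B'‖ < a → ‖D2 (H₀ B')‖ < jG →
      Ineq189 (supSize (cubeGeometry L j S T) (boxS L j S T) (blkS L j S T) : BlockNorm (cubeGeometry L j S T) (S → 𝔸)) b3
        ((fderiv ℂ W (solA180 𝒢 W D2 H₀ ε₄ B' + H₀ B')).restrictScalars ℝ : (S → 𝔸) →ₗ[ℝ] 𝒵) θW δ₀)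
    (hqG : qG b3.κ 1 BG θW (B6.c0 δ₀ (1 / 8) ^ d) < 1)
    (Hl : (T → 𝔸) → X → E) (dH : Icc (0:ℝ) 1 → (T → 𝔸) →ₗ[ℝ] (X → E))
    (hHl : ∀ B' : T → 𝔸, Hl B' = fun x => ev x (chartH179 𝒢 W D2 H₀
      (fun Y : S → 𝔸 => Y - H (Dfix (B11Eq44Concrete.Cmap L U₀ S T j) (H : (T → 𝔸) →ₗ[ℂ] (S → 𝔸))
        ((8 * (131072 * ((d : ℝ) + 1) ^ 2) * Real.exp (4 * (800 * ((d : ℝ) + 1) ^ 2 * ((d : ℝ) + 4)) * α₀)) * ((L : ℝ) ^ j) ^ 2) Y))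
      ε₄ B'))
    (hdH : ∀ t : Icc (0:ℝ) 1, dH t = (LinearMap.pi fun x => ((ev x : (S → 𝔸) →L[ℝ] E) : (S → 𝔸) →ₗ[ℝ] E)) ∘ₗ
      ((fderiv ℂ (chartH179 𝒢 W D2 H₀
        (fun Y : S → 𝔸 => Y - H (Dfix (B11Eq44Concrete.Cmap L U₀ S T j) (H : (T → 𝔸) →ₗ[ℂ] (S → 𝔸))
          ((8 * (131072 * ((d : ℝ) + 1) ^ 2) * Real.exp (4 * (800 * ((d : ℝ) + 1) ^ 2 * ((d : ℝ) + 4)) * α₀)) * ((L : ℝ) ^ j) ^ 2) Y))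
        ε₄) ((t : ℝ) • B)).restrictScalars ℝ : (T → 𝔸) →ₗ[ℝ] (S → 𝔸)))
    (y : (cubeGeometry L j S T).Site) :
    (∀ t : Icc (0:ℝ) 1, Ineq190 (supSize (cubeGeometry L j S T) (boxT L j S T) (blkT L j S T) : BlockNorm (cubeGeometry L j S T) (T → 𝔸))
        (supSize (cubeGeometry L j S T) box blk : BlockNorm (cubeGeometry L j S T) (X → E)) (dH t)
        (const190 1 1 b3.κ BG θW cΔ (d * B₁' * Real.exp (d * δ₀)) (d * B₁ * Real.exp (d * δ₀))
          (d * Real.exp (1 / 2 * d * δ₀) *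
            ((1 - (C3Gen d L * (((L : ℝ) ^ j) ^ 2 * (2 * ε₃)) * (2 * d) * B₁ * Real.exp (2 * d * δ₀)) *
                (d * B6.c0 δ₀ (1 / 2) ^ d))⁻¹ * (Real.exp (d * δ₀) * (C3Gen d L * ((L : ℝ) ^ j) ^ 2 * (2 * ε₃)))))
          (B6.c0 δ₀ (1 / 8) ^ d)) δ₀) ∧
      ∀ s : ℝ, (∀ t, (supSize (cubeGeometry L j S T) box blk : BlockNorm (cubeGeometry L j S T) (X → E)).loc y (dH t B) ≤ s) →
        (supSize (cubeGeometry L j S T) box blk : BlockNorm (cubeGeometry L j S T) (X → E)).loc y (Hl B) ≤ s := by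
  have hL1 : 1 ≤ L := le_trans (by norm_num) hL
  have hA₀ : 0 ≤ (d : ℝ) * B₁' * Real.exp (d * δ₀) := by positivity
  have hH0 := hasMaj_H_of_kernel hL1 j S T H₀ hB₁' hδ₀.le hH0ker
  exact ineq190_and_hmv_supSize_concreteC_hker L hL hG k U₀ hU₀ hα hα3 hα4 h52 hb hsmall hc₃ h145 h155 S T hj hd1 R hWa H hB₀'
    hH46 hc1h hε₃ h18 h2 hnest hδ₀ hB₁ hHker hq hB ev hev hBG hθW hcΔ hA₀ hG190 hD2H0 hH0 h189 hqG Hl dH hHl hdH y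

end Chain

end Literature.MathematicalPhysics.QuantumFieldTheory.Balaban1983to89.B11HKernelHasMajConcrete
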